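import Mathlib
import Summits.NavierStokesRegularity.NavierStokesRegularity.Theorems.WakeRatchetTailRatchetScalarFrontLimit
import Summits.NavierStokesRegularity.NavierStokesRegularity.Theorems.WakeRatchetTailRatchetScalarFrontWake
import HarnessLib

/-!
# Scalar dyadic fronts (construction `DyadicScalarFronts`, stmt-NavierStokesRegularity-21808):
# the item's own clauses already give the scale bound `|t|·|a(t)| ≤ C`, entry from rest, and the wake identity

`WakeRatchetDyadicFront.DyadicScalarFronts` (p589335) asks for a profile `a` of the scalar front equation on
`t < 0` that is integrable on `(−∞,0)`, bounded near `0⁻` and non-trivial.  Through the tree's dictionary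
(`isDSSWave_dyadic_of_scalarFront`: `Φ(x) = e^{−x} a(−e^{−x}) e₀` is an admissible DSS wave of the dyadic member)
and `IsDSSWave.uniformBound` (every admissible DSS wave has bounded profiles), these clauses ALONE imply
(`scale_bound`) the type-I bound `|t|·|a(t)| ≤ C` on `t < 0`, hence (`bounded`, `tendsto_atBot`) a global bound
and entry from rest `a(t) → 0` as `t → −∞`.  Consequently the a-priori package of the two companion files applies
to every profile the construction item could deliver, with no extra hypothesis (`wake_identity_of_front`):
the wake `L = a(0⁻)` exists and `L² = 2(Λ/s − s/Λ)·∫_{t<0} a(t)² a(st) dt`; in particular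
(`lt_bigLam_of_front`) positive throughput and a non-zero wake force `s < Λ`, i.e. `μ = s²/Λ² < 1`.

HONEST FRAMING: elementary consequences of tree theorems about a MODEL lattice ODE (Tao 2016 §1.2, §4);
existence of such fronts stays open; nothing here concerns the Navier–Stokes equations; no item is closed.
-/

noncomputable section

set_option linter.dupNamespace false

namespace Summit.NavierStokesRegularity.NavierStokesRegularity.Theorems

namespace WakeRatchetScalarFrontAdmissible

open Filter Topology Set MeasureTheory
open Literature.Analysis.FluidPDE Literature.Analysis.FluidPDE.TaoCascade
open WakeRatchetDyadicFront WakeRatchetScalarFront WakeRatchetScalarFrontWake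

variable {ε₀ s : ℝ} {a : ℝ → ℝ}

/-- **Scale (type-I) bound from the item's clauses**: `|t|·|a(t)| ≤ C` on `t < 0` — the profile norm of the
dictionary DSS wave, bounded by `IsDSSWave.uniformBound`.
[cite: Tao2016AveragedNS, §4 Lemma 4.1 (4.8); cell theorem (`IsDSSWave.uniformBound`)] -/
theorem scale_bound (hε : 0 < ε₀) (hs : 1 < s)
    (hode : ∀ t : ℝ, t < 0 → HasDerivAt a
      (bigLam ε₀ / s ^ 2 * a (t / s) ^ 2 - s / bigLam ε₀ * a t * a (s * t)) t)
    (hint : IntegrableOn a (Iio 0))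
    (hbdd : ∃ t₀ : ℝ, t₀ < 0 ∧ ∃ P : ℝ, ∀ t : ℝ, t₀ ≤ t → t < 0 → |a t| ≤ P) :
    ∃ C : ℝ, ∀ t : ℝ, t < 0 → |t| * |a t| ≤ C := by
  obtain ⟨C, hC⟩ := (isDSSWave_dyadic_of_scalarFront hε hs hode hint hbdd).uniformBound
  refine ⟨C, fun t ht => ?_⟩
  have h := hC 0 (-Real.log (-t))
  have e1 : Real.exp (-(-Real.log (-t))) = -t := by rw [neg_neg, Real.exp_log (neg_pos.2 ht)]
  rw [e1, neg_neg, norm_smul, Real.norm_eq_abs, abs_mul, abs_neg] at h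
  simpa using h

/-- **Global bound**: the profile is bounded on all of `t < 0`. [elementary] -/
theorem bounded (hε : 0 < ε₀) (hs : 1 < s)
    (hode : ∀ t : ℝ, t < 0 → HasDerivAt a
      (bigLam ε₀ / s ^ 2 * a (t / s) ^ 2 - s / bigLam ε₀ * a t * a (s * t)) t)
    (hint : IntegrableOn a (Iio 0))
    (hbdd : ∃ t₀ : ℝ, t₀ < 0 ∧ ∃ P : ℝ, ∀ t : ℝ, t₀ ≤ t → t < 0 → |a t| ≤ P) :
    ∃ P' : ℝ, ∀ t : ℝ, t < 0 → |a t| ≤ P' := by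
  obtain ⟨C, hC⟩ := scale_bound hε hs hode hint hbdd
  obtain ⟨t₀, ht₀, P, hP⟩ := hbdd
  refine ⟨max P (C / |t₀|), fun t ht => ?_⟩
  rcases le_or_gt t₀ t with h | h
  · exact (hP t h ht).trans (le_max_left _ _)
  · have ht0 : 0 < |t| := abs_pos.2 ht.ne
    have h1 : |a t| ≤ C / |t| := by
      rw [le_div_iff₀ ht0, mul_comm]; exact hC t ht
    have h2 : C / |t| ≤ C / |t₀| := by
      have hC0 : 0 ≤ C := le_trans (by positivity) (hC t ht)
      apply div_le_div_of_nonneg_left hC0 (abs_pos.2 ht₀.ne)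
      rw [abs_of_neg ht₀, abs_of_neg ht]; linarith
    exact (h1.trans h2).trans (le_max_right _ _)

/-- **Entry from rest**: `a(t) → 0` as `t → −∞` (from `|a(t)| ≤ C/|t|`). [elementary] -/
theorem tendsto_atBot (hε : 0 < ε₀) (hs : 1 < s)
    (hode : ∀ t : ℝ, t < 0 → HasDerivAt a
      (bigLam ε₀ / s ^ 2 * a (t / s) ^ 2 - s / bigLam ε₀ * a t * a (s * t)) t)
    (hint : IntegrableOn a (Iio 0))
    (hbdd : ∃ t₀ : ℝ, t₀ < 0 ∧ ∃ P : ℝ, ∀ t : ℝ, t₀ ≤ t → t < 0 → |a t| ≤ P) :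
    Tendsto a atBot (𝓝 0) := by
  obtain ⟨C, hC⟩ := scale_bound hε hs hode hint hbdd
  have hC0 : 0 ≤ C := le_trans (by positivity) (hC (-1) (by norm_num))
  refine Metric.tendsto_nhds.2 fun ε hε' => ?_
  refine Filter.eventually_atBot.2 ⟨-(C / ε + 1), fun t ht => ?_⟩
  rw [Real.dist_eq, sub_zero]
  have hpos : 0 < C / ε + 1 := by
    have := div_nonneg hC0 hε'.le
    linarith
  have htneg : t < 0 := by linarith
  have habs : C / ε + 1 ≤ |t| := by rw [abs_of_neg htneg]; linarith
  have ht0 : 0 < |t| := lt_of_lt_of_le hpos habs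
  have h1 : |a t| ≤ C / |t| := by rw [le_div_iff₀ ht0, mul_comm]; exact hC t htneg
  have h2 : C / |t| < ε := by
    rw [div_lt_iff₀ ht0]
    have : C < ε * (C / ε + 1) := by rw [mul_add, mul_div_cancel₀ C hε'.ne']; linarith
    nlinarith
  linarith

/-- **The wake identity for every profile of the construction item** (no extra hypothesis): the wake
`L = a(0⁻)` exists and `L² = 2(Λ/s − s/Λ) ∫_{t<0} a(t)² a(st) dt`.
[cite: Tao2016AveragedNS, §1.2, §4; elementary] -/
theorem wake_identity_of_front (hε : 0 < ε₀) (hs : 1 < s)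
    (hode : ∀ t : ℝ, t < 0 → HasDerivAt a
      (bigLam ε₀ / s ^ 2 * a (t / s) ^ 2 - s / bigLam ε₀ * a t * a (s * t)) t)
    (hint : IntegrableOn a (Iio 0))
    (hbdd : ∃ t₀ : ℝ, t₀ < 0 ∧ ∃ P : ℝ, ∀ t : ℝ, t₀ ≤ t → t < 0 → |a t| ≤ P) :
    ∃ L : ℝ, Tendsto a (𝓝[<] 0) (𝓝 L) ∧
      L ^ 2 = 2 * (bigLam ε₀ / s - s / bigLam ε₀) * ∫ t in Iio 0, a t ^ 2 * a (s * t) := by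
  obtain ⟨L, hL⟩ := exists_wake_limit hε hs hode hbdd
  obtain ⟨P', hP'⟩ := bounded hε hs hode hint hbdd
  exact ⟨L, hL, wake_identity hε hs hode hP' hint (tendsto_atBot hε hs hode hint hbdd) hL⟩

/-- **Positive throughput and a non-zero wake force `μ < 1`** for every profile of the construction item.
[cite: Tao2016AveragedNS, §1.2, §4 (4.1); elementary] -/
theorem lt_bigLam_of_front (hε : 0 < ε₀) (hs : 1 < s)
    (hode : ∀ t : ℝ, t < 0 → HasDerivAt a
      (bigLam ε₀ / s ^ 2 * a (t / s) ^ 2 - s / bigLam ε₀ * a t * a (s * t)) t)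
    (hint : IntegrableOn a (Iio 0))
    (hbdd : ∃ t₀ : ℝ, t₀ < 0 ∧ ∃ P : ℝ, ∀ t : ℝ, t₀ ≤ t → t < 0 → |a t| ≤ P)
    (hQ : 0 < ∫ t in Iio 0, a t ^ 2 * a (s * t))
    (hwake : ∀ L : ℝ, Tendsto a (𝓝[<] 0) (𝓝 L) → L ≠ 0) :
    s < bigLam ε₀ ∧ dssMu ε₀ (Real.log s) < 1 := by
  obtain ⟨L, hL⟩ := exists_wake_limit hε hs hode hbdd
  obtain ⟨P', hP'⟩ := bounded hε hs hode hint hbdd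
  have hb := tendsto_atBot hε hs hode hint hbdd
  exact ⟨lt_bigLam_of_wake hε hs hode hP' hint hb hL (hwake L hL) hQ,
    dssMu_lt_one_of_wake hε hs hode hP' hint hb hL (hwake L hL) hQ⟩

end WakeRatchetScalarFrontAdmissible

end Summit.NavierStokesRegularity.NavierStokesRegularity.Theorems

end
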